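import Literature.AlgebraicGeometry.Resolution.AlterationsMultisectionLocal
import HarnessLib

/-!
# De Jong's alteration theorem: the local step of Lemma 4.13 cut along its printed proof

Topic: `Literature/AlgebraicGeometry/Resolution`. Third layer under `AlterationsMultisection.lean`:
`AlterationsMultisectionLocal.lean` vendors the local step of de Jong 1996, Lemma 4.13 at one
closed point `y ∈ Y` as the named fact `DeJong1996MultisectionLocal` and PROVES Lemma 4.13 from
it (`DeJong1996MultisectionLemma.of_local`, the Noetherian induction). The printed proof of the
local step (pp. 69–70) has three inputs of different nature, which this file separates:

> (A) "Let `ℒ` be a very ample line bundle on `X` and let `i : X → 𝐏 = 𝐏(Γ(X, ℒ^{⊗n}))` be the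
> projective embedding associated to `ℒ^{⊗n}`. Note that for any irreducible curve `C ⊂ X`, the
> curve `i(C) ⊂ 𝐏` is not contained in any linear subspace of dimension `n - 1`. […]
> `T = {(H, y) ∈ 𝐏^∨ × Y | dim f⁻¹(y) ∩ H = 1}` […] `dim T ≤ dim Y + dim 𝐏^∨ - n` […]
> `pr₁(T) ≠ 𝐏^∨`. Let `y ∈ Y(k)` be a closed point. Consider
> `U = {H ∈ 𝐏^∨ | H ∉ pr₁(T), H ∩ f⁻¹(y) ⊂ sm(X/Y), H ∩ f⁻¹(y) is a reduced scheme}`. Here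
> `f⁻¹(y)` denotes the scheme-theoretic fibre. […] `U ⊂ 𝐏^∨` is nonempty open. Take `H' ∈ U`
> and put `H = X ∩ H'`. The morphism `f|_H : H → Y` is quasi-finite hence finite (as
> `H' ∉ pr₁(T)`)." — and, at the end — "Note that `G ∩ H` consists of exactly `deg G` points
> (over `κ(ȳ)`) in view of a). […] The degree of `G` in `𝐏` is at least `n`, hence if `n ≥ 3`
> we get our claim."
>
> (B) "At each of the intersection points `x ∈ f⁻¹(y) ∩ H` we have `𝒪_{X,x}` [smooth over
> `𝒪_{Y,y}`] since `f` is smooth at `x`. Further `H` is defined by `(h) ⊂ 𝒪_{X,x}` with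
> `h̄ ∉ 𝔪²_{x, f⁻¹(y)}`, as `H ∩ f⁻¹(y)` [is reduced]. Therefore `f|_H : H → Y` is finite
> étale over a neighbourhood of `y` in `Y`."
>
> (C) "Any component of `H` dominates `Y` in view of dimensions, hence `f|_H` is generically
> étale."
>
> (D) "We claim that there exists an open neighbourhood `U ⊂ Y` of `y` such that (ii) holds for
> geometric points of `U`. Indeed, any open neighbourhood `U ⊂ Y` such that a)
> `f : H ∩ f⁻¹(U) → U` is finite étale and b) `H ∩ f⁻¹(U) ⊂ sm(X/Y)` works. We can find `U`
> with a), see above, and b) will follow after shrinking `U`, as `H ∩ f⁻¹(y) ⊂ sm(X/Y)` and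
> [`f|_H` is closed]. Choose any geometric point `ȳ` of `U` and a component `G` of `X_ȳ`. Note
> that `G ∩ H` consists of exactly `deg G` points (over `κ(ȳ)`) in view of a). Furthermore,
> these are all contained in `sm(X/Y)` in view of b)." (p. 70)

Accordingly:

* NAMED FACT `DeJong1996MultisectionHyperplane` — (A): the hyperplane section `H = X ∩ H'`,
  `H' ∈ U`, delivered as an effective Cartier divisor `I` of `X` (2.3) with (A2) "`H' ∉ pr₁(T)`":
  `dim (H ∩ f⁻¹(y')) ≤ 0` for every `y' ∈ Y`; (A3) `H ∩ f⁻¹(y) ⊂ sm(X/Y)`; (A4) the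
  scheme-theoretic `H ∩ f⁻¹(y)` (Mathlib: the fibre `(I.subschemeι ≫ f).fiber y`) is reduced;
  (A5) the degree clause "`G ∩ H` consists of exactly `deg G ≥ n ≥ 3` points" for every
  component `G` of every geometric fibre `X_ȳ` over which `H_ȳ` is reduced. Inputs: very ample
  line bundles and the dual projective space, the incidence variety `T` and 2.7, Bertini on one
  fibre, the degree of a projective curve — none of which is in Mathlib.
* NAMED FACT `DeJong1996MultisectionEtaleNhd` — (B): for such an `I` with `f|_H` finite, (A3)
  and (A4), `f|_H` is étale over an open neighbourhood of `y` (the slicing criterion for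
  flatness along a fibrewise regular parameter, unramifiedness read off the fibre, openness of
  the étale locus and closedness of `f|_H`).
* NAMED FACT `DeJong1996MultisectionGenericallyEtale` — (C): for such an `I` with `f|_H` finite
  and étale over a non-empty open of `Y`, `f|_H` (reduced structure, 2.2) is finite and
  generically étale, `DeJong1996.IsFiniteGenericallyEtaleOn f H` (dimension theory: `dim X =
  dim Y + 1`, Krull's Hauptidealsatz and catenarity for the components of `H`, finite morphisms
  preserve dimension).
* PROVED: "quasi-finite hence finite" — `isFinite_subschemeι_comp_of_topologicalKrullDim_le_zero`
  (a Noetherian `T₀` space of dimension `≤ 0` is finite, `finite_of_topologicalKrullDim_le_zero`;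
  then Zariski's Main Theorem in Mathlib's form `IsFinite.of_isProper_of_locallyQuasiFinite`);
  the shrinking for b) — `exists_opens_support_inter_preimage_subset_smoothLocus`; (D) —
  `DeJong1996.HasThreeSmoothPointsOver.of_etale_morphismRestrict` (a geometric fibre of `H` over
  the étale locus is étale over an algebraically closed field, hence reduced,
  `isReduced_pullback_of_etale_morphismRestrict`, so (A5) applies and b) puts the points in
  `sm(X/Y)`); and the assembly
  **`DeJong1996MultisectionLocal.of_hyperplane_of_etaleNhd_of_genericallyEtale`**, whence
  Lemma 4.13 (`DeJong1996MultisectionLemma`) and the downstream rewirings from the three facts.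

## Sources

* A. J. de Jong, *Smoothness, semi-stability and alterations*, Publ. Math. IHÉS 83 (1996) 51–93:
  2.2, 2.3, 2.5–2.7 (pp. 54–55), Lemma 4.13 and its proof (pp. 69–70). [DeJong1996]
* The Stacks Project, Tag 02LS (finite = proper + locally quasi-finite). [StacksProject]
-/

noncomputable section

open CategoryTheory CategoryTheory.Limits AlgebraicGeometry TopologicalSpace Topology

namespace Literature.AlgebraicGeometry.Resolution

universe u

/-! ## Dimension `≤ 0` and finiteness -/

/-- A Noetherian `T₀` topological space of Krull dimension `≤ 0` is finite: every irreducible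
component is the closure of each of its points (no chain of length `1`), hence a single point by
`T₀`, and there are finitely many components. [folklore] -/
theorem finite_of_topologicalKrullDim_le_zero {α : Type*} [TopologicalSpace α] [T0Space α]
    [NoetherianSpace α] (h : topologicalKrullDim α ≤ 0) : Finite α := by
  have hmax : ∀ A : IrreducibleCloseds α, IsMax A := Order.krullDim_nonpos_iff_forall_isMax.mp h
  -- every irreducible component is a single point
  have hsub : ∀ C ∈ irreducibleComponents α, C.Subsingleton := by
    intro C hC
    have hCcl : IsClosed C := isClosed_of_mem_irreducibleComponents C hC
    have hcl : ∀ z ∈ C, closure {z} = C := by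
      intro z hz
      have hle : closure {z} ⊆ C := closure_minimal (Set.singleton_subset_iff.mpr hz) hCcl
      have hge : (⟨C, hC.1, hCcl⟩ : IrreducibleCloseds α) ≤
          ⟨closure {z}, isIrreducible_singleton.closure, isClosed_closure⟩ :=
        hmax ⟨closure {z}, isIrreducible_singleton.closure, isClosed_closure⟩
          (b := ⟨C, hC.1, hCcl⟩) (fun x hx => hle hx)
      exact Set.Subset.antisymm hle fun x hx => hge hx
    intro x hx x' hx'
    exact (inseparable_iff_closure_eq.mpr ((hcl x hx).trans (hcl x' hx').symm)).eq
  have hcover : (⋃ C ∈ irreducibleComponents α, C) = (Set.univ : Set α) :=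
    Set.eq_univ_of_forall fun x =>
      Set.mem_biUnion (irreducibleComponent_mem_irreducibleComponents x) mem_irreducibleComponent
  have hfin : (Set.univ : Set α).Finite := by
    rw [← hcover]
    exact NoetherianSpace.finite_irreducibleComponents.biUnion fun C hC => (hsub C hC).finite
  exact Set.finite_univ_iff.mp hfin

/-- A subset of Krull dimension `≤ 0` (subspace topology) of a Noetherian `T₀` space is finite.
[folklore] -/
theorem set_finite_of_topologicalKrullDim_le_zero {α : Type*} [TopologicalSpace α] [T0Space α]
    [NoetherianSpace α] (S : Set α) (h : topologicalKrullDim S ≤ 0) : S.Finite :=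
  haveI : NoetherianSpace S := NoetherianSpace.set S
  Set.finite_coe_iff.mp (finite_of_topologicalKrullDim_le_zero h)

/-- **"The morphism `f|_H : H → Y` is quasi-finite hence finite"** (de Jong 1996, proof of 4.13):
if `f : X → Y` is proper, `X` is Noetherian and the closed subscheme `H = V(I)` meets every fibre
`f⁻¹(y')` in a set of dimension `≤ 0`, then `f|_H` has finite fibres, so is locally quasi-finite,
and being proper it is finite (Zariski's Main Theorem, Stacks 02LS; Mathlib
`IsFinite.of_isProper_of_locallyQuasiFinite`). [cite: DeJong1996, Lemma 4.13 (proof), p. 70] -/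
theorem isFinite_subschemeι_comp_of_topologicalKrullDim_le_zero {X Y : Scheme.{u}} (f : X ⟶ Y)
    [IsProper f] [NoetherianSpace X] (I : X.IdealSheafData)
    (h : ∀ y' : Y, topologicalKrullDim ↥((I.support : Set X) ∩ f ⁻¹' {y'}) ≤ 0) :
    IsFinite (I.subschemeι ≫ f) := by
  haveI : LocallyQuasiFinite (I.subschemeι ≫ f) := by
    refine .of_finite_preimage_singleton _ fun y' => ?_
    have hfin : ((I.support : Set X) ∩ f ⁻¹' {y'}).Finite :=
      set_finite_of_topologicalKrullDim_le_zero _ (h y')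
    refine (hfin.preimage I.subschemeι.isClosedEmbedding.injective.injOn).subset ?_
    intro z hz
    refine ⟨?_, ?_⟩
    · rw [← Scheme.IdealSheafData.range_subschemeι]
      exact ⟨z, rfl⟩
    · show f (I.subschemeι z) ∈ ({y'} : Set Y)
      rw [← Scheme.Hom.comp_apply]
      exact hz
  exact IsFinite.of_isProper_of_locallyQuasiFinite _

/-! ## Shrinking the neighbourhood: b) -/

/-- **"b) will follow after shrinking `U`, as `H ∩ f⁻¹(y) ⊂ sm(X/Y)`"** (de Jong 1996, proof
of 4.13): if `f|_H : H = V(I) → Y` is a closed map (e.g. finite) and `H ∩ f⁻¹(y) ⊂ sm(X/Y)`,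
every open neighbourhood `V` of `y` contains an open neighbourhood `V'` of `y` with
`H ∩ f⁻¹(V') ⊂ sm(X/Y)` — remove the closed set `f(H ∖ sm(X/Y))`, which misses `y`.
[cite: DeJong1996, Lemma 4.13 (proof), p. 70] -/
theorem exists_opens_support_inter_preimage_subset_smoothLocus {X Y : Scheme.{u}} (f : X ⟶ Y)
    [LocallyOfFinitePresentation f] (I : X.IdealSheafData) [UniversallyClosed (I.subschemeι ≫ f)]
    {y : Y} (hsm : (I.support : Set X) ∩ f ⁻¹' {y} ⊆ f.smoothLocus) (V : Y.Opens) (hyV : y ∈ V) :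
    ∃ V' : Y.Opens, V' ≤ V ∧ y ∈ V' ∧
      (I.support : Set X) ∩ f ⁻¹' (V' : Set Y) ⊆ f.smoothLocus := by
  -- the closed set of non-smooth points of `H` and its closed image
  set F : Set X := (I.support : Set X) ∩ (f.smoothLocus : Set X)ᶜ with hF
  have hFc : IsClosed F := I.support.isClosed.inter f.smoothLocus.isOpen.isClosed_compl
  have himg : IsClosed (f '' F) := by
    have hcl : IsClosedMap (I.subschemeι ≫ f) := (I.subschemeι ≫ f).isClosedMap
    have he : f '' F = (I.subschemeι ≫ f) '' (I.subschemeι ⁻¹' F) := by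
      ext y'
      constructor
      · rintro ⟨x, hx, rfl⟩
        have hxr : x ∈ Set.range I.subschemeι := by
          rw [Scheme.IdealSheafData.range_subschemeι]
          exact hx.1
        obtain ⟨z, rfl⟩ := hxr
        exact ⟨z, hx, Scheme.Hom.comp_apply _ _ _⟩
      · rintro ⟨z, hz, rfl⟩
        exact ⟨I.subschemeι z, hz, (Scheme.Hom.comp_apply _ _ _).symm⟩
    rw [he]
    exact hcl _ (hFc.preimage I.subschemeι.continuous)
  have hy : y ∉ f '' F := by
    rintro ⟨x, ⟨hxH, hxsm⟩, hxy⟩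
    exact hxsm (hsm ⟨hxH, hxy⟩)
  refine ⟨V ⊓ ⟨(f '' F)ᶜ, himg.isOpen_compl⟩, inf_le_left, ⟨hyV, hy⟩, ?_⟩
  rintro x ⟨hxH, hxV'⟩
  by_contra hx
  exact hxV'.2 ⟨x, ⟨hxH, hx⟩, rfl⟩

/-! ## Étale over an open of the base -/

/-- Étaleness over an open `V` of the base passes to smaller opens `V' ≤ V`. [folklore] -/
theorem etale_morphismRestrict_of_le {X Y : Scheme.{u}} (g : X ⟶ Y) {V V' : Y.Opens}
    (h : V' ≤ V) [Etale (g ∣_ V)] : Etale (g ∣_ V') := by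
  have e : V.ι ''ᵁ (V.ι ⁻¹ᵁ V') = V' := by
    rw [Scheme.Hom.image_preimage_eq_opensRange_inf, Scheme.Opens.opensRange_ι,
      inf_eq_right.mpr h]
  exact (MorphismProperty.arrow_mk_iso_iff @Etale
    (morphismRestrictRestrict g V (V.ι ⁻¹ᵁ V') ≪≫ morphismRestrictEq g e)).mp inferInstance

/-- **A geometric fibre over the étale locus is reduced**: if `g : H → Y` is étale over the open
`V ⊆ Y` and the geometric point `ȳ : Spec K → Y` lands in `V`, then `H_ȳ = H ×_Y Spec K` is
étale over `Spec K` (base change), hence smooth over a field, hence reduced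
(`Literature.AlgebraicGeometry.Motives.isReduced_of_smooth_over_field`, Stacks 056T). This is
"in view of a)" in de Jong's count of the points of `G ∩ H`. [folklore] -/
theorem isReduced_pullback_of_etale_morphismRestrict {H Y : Scheme.{u}} (g : H ⟶ Y)
    (V : Y.Opens) [Etale (g ∣_ V)] {K : Type u} [Field K] (yb : Spec (.of K) ⟶ Y)
    (hyb : Set.range yb ⊆ V) : IsReduced (pullback g yb) := by
  -- factor `ȳ` through `V` and `pullback.fst` through `g ⁻¹ᵁ V`
  let yb' : Spec (.of K) ⟶ V := IsOpenImmersion.lift V.ι yb (by rwa [Scheme.Opens.range_ι])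
  have hyb' : yb' ≫ V.ι = yb := IsOpenImmersion.lift_fac _ _ _
  have hrange : Set.range (pullback.fst g yb) ⊆ Set.range (g ⁻¹ᵁ V).ι := by
    rintro _ ⟨p, rfl⟩
    rw [Scheme.Opens.range_ι]
    show g (pullback.fst g yb p) ∈ V
    rw [← Scheme.Hom.comp_apply, pullback.condition, Scheme.Hom.comp_apply]
    exact hyb ⟨_, rfl⟩
  let q : pullback g yb ⟶ (g ⁻¹ᵁ V : H.Opens) := IsOpenImmersion.lift (g ⁻¹ᵁ V).ι _ hrange
  have hq : q ≫ (g ⁻¹ᵁ V).ι = pullback.fst g yb := IsOpenImmersion.lift_fac _ _ _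
  -- the square over `g ∣_ V` is a pullback, by pasting with the restriction square
  have outer : IsPullback (pullback.snd g yb) (q ≫ (g ⁻¹ᵁ V).ι) (yb' ≫ V.ι) g := by
    rw [hq, hyb']
    exact (IsPullback.of_hasPullback g yb).flip
  have comm : pullback.snd g yb ≫ yb' = q ≫ (g ∣_ V) := by
    rw [← cancel_mono V.ι, Category.assoc, Category.assoc, hyb', morphismRestrict_ι,
      ← Category.assoc, hq, pullback.condition]
  have top : IsPullback (pullback.snd g yb) q yb' (g ∣_ V) :=
    IsPullback.of_bot outer comm (isPullback_morphismRestrict g V)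
  haveI : Etale (pullback.snd g yb) := MorphismProperty.of_isPullback top.flip inferInstance
  exact Literature.AlgebraicGeometry.Motives.isReduced_of_smooth_over_field (pullback.snd g yb)

/-! ## (D): (ii) over the étale locus -/

namespace DeJong1996.HasThreeSmoothPointsOver

/-- **de Jong 1996, proof of 4.13, (ii) over `U`**: "any open neighbourhood `U ⊂ Y` such that
a) `f : H ∩ f⁻¹(U) → U` is finite étale and b) `H ∩ f⁻¹(U) ⊂ sm(X/Y)` works. […] Choose any
geometric point `ȳ` of `U` and a component `G` of `X_ȳ`. Note that `G ∩ H` consists of exactly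
`deg G` points (over `κ(ȳ)`) in view of a). Furthermore, these are all contained in `sm(X/Y)`
in view of b). The degree of `G` in `𝐏` is at least `n`, hence if `n ≥ 3` we get our claim."
Here the degree count enters as the hypothesis `hdeg` (clause (A5) of
`DeJong1996MultisectionHyperplane`): whenever the geometric fibre `H_ȳ` is reduced, every
component `G` of `X_ȳ` meets `H` in at least `3` points; a) makes `H_ȳ` reduced
(`isReduced_pullback_of_etale_morphismRestrict`) and b) puts these points in `sm(X/Y) ∩ H`.
[cite: DeJong1996, Lemma 4.13 (proof), p. 70] -/
theorem of_etale_morphismRestrict {X Y : Scheme.{u}} {f : X ⟶ Y} [LocallyOfFinitePresentation f]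
    (I : X.IdealSheafData) (V : Y.Opens) [Etale ((I.subschemeι ≫ f) ∣_ V)]
    (hb : (I.support : Set X) ∩ f ⁻¹' (V : Set Y) ⊆ f.smoothLocus)
    (hdeg : ∀ (K : Type u) [Field K] [IsAlgClosed K] (yb : Spec (.of K) ⟶ Y),
      IsReduced (pullback (I.subschemeι ≫ f) yb) →
        ∀ C ∈ irreducibleComponents ↥(pullback f yb),
          3 ≤ (C ∩ (pullback.fst f yb) ⁻¹' (I.support : Set X)).encard) :
    HasThreeSmoothPointsOver f I.support V := by
  intro K _ _ yb hyb C hC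
  have hred : IsReduced (pullback (I.subschemeι ≫ f) yb) :=
    isReduced_pullback_of_etale_morphismRestrict _ V yb hyb
  refine (hdeg K yb hred C hC).trans (Set.encard_le_encard (Set.inter_subset_inter_right _ ?_))
  intro z hz
  refine ⟨hb ⟨hz, ?_⟩, hz⟩
  show f (pullback.fst f yb z) ∈ (V : Set Y)
  rw [← Scheme.Hom.comp_apply, pullback.condition, Scheme.Hom.comp_apply]
  exact hyb ⟨_, rfl⟩

end DeJong1996.HasThreeSmoothPointsOver

/-! ## The three inputs of the local step as named facts -/

/-- NAMED FACT — **de Jong 1996, proof of Lemma 4.13: the hyperplane section at a closed point.**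
For `f : X → Y` as in Lemma 4.13 (projective varieties over an algebraically closed `k`, (vi) a),
b), rendered exactly as in `DeJong1996MultisectionLemma`) and a closed point `y ∈ Y(k)`: "Let `ℒ`
be a very ample line bundle on `X` and let `i : X → 𝐏 = 𝐏(Γ(X, ℒ^{⊗n}))` be the projective
embedding associated to `ℒ^{⊗n}`. Note that for any irreducible curve `C ⊂ X`, the curve
`i(C) ⊂ 𝐏` is not contained in any linear subspace of dimension `n - 1`. […]
`T = {(H, y) ∈ 𝐏^∨ × Y | dim f⁻¹(y) ∩ H = 1}` [is closed, 2.7, and] `dim T ≤ dim Y + dim 𝐏^∨ - n`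
[…] In particular, `pr₁(T) ≠ 𝐏^∨`. Let `y ∈ Y(k)` be a closed point. Consider
`U = {H ∈ 𝐏^∨ | H ∉ pr₁(T), H ∩ f⁻¹(y) ⊂ sm(X/Y), H ∩ f⁻¹(y) is a reduced scheme}`. Here
`f⁻¹(y)` denotes the scheme-theoretic fibre. […] (if `n` is large enough) `U ⊂ 𝐏^∨` is nonempty
open. Take `H' ∈ U` and put `H = X ∩ H'`." together with the degree count used at the end of
the proof: "Note that `G ∩ H` consists of exactly `deg G` points (over `κ(ȳ)`) [when `H_ȳ` is
reduced] […] The degree of `G` in `𝐏` is at least `n`, hence if `n ≥ 3` we get our claim."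
Rendered: there is an effective Cartier divisor `I` on `X` (the hyperplane section of the
integral `X`, 2.3) with (A2) `H' ∉ pr₁(T)`: for every `y' ∈ Y` the set `H ∩ f⁻¹(y')` has
dimension `≤ 0`; (A3) `H ∩ f⁻¹(y) ⊂ sm(X/Y)`; (A4) the scheme-theoretic fibre of `f|_H` at `y`
is reduced; (A5) for every algebraically closed `K`, every `ȳ : Spec K → Y` such that
`H_ȳ = H ×_Y Spec K` is reduced, and every irreducible component `G` of `X_ȳ`, at least `3`
points of `G` map to `H`. Users take `(h : DeJong1996MultisectionHyperplane)`.
[cite: DeJong1996, Lemma 4.13 (proof), pp. 69–70] -/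
def DeJong1996MultisectionHyperplane : Prop :=
  ∀ (k : Type u) [Field k] [IsAlgClosed k] (X Y : Scheme.{u}) [IsIntegral X] [IsIntegral Y]
    (f : X ⟶ Y) [LocallyOfFinitePresentation f] (g : Y ⟶ Spec (.of k)),
    Literature.AlgebraicGeometry.Motives.IsProjectiveOver (Over.mk (f ≫ g)) →
      Literature.AlgebraicGeometry.Motives.IsProjectiveOver (Over.mk g) →
        Surjective f → GeometricallyConnected f →
          (∀ (y : Y), ∀ C ∈ irreducibleComponents ↥(f.fiber y), topologicalKrullDim ↥C = 1) →
            (∀ y : Y, Dense ((f.fiberι y) ⁻¹' (f.smoothLocus : Set X))) →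
              ∀ y : Y, IsClosed ({y} : Set Y) →
                ∃ I : X.IdealSheafData, IsEffectiveCartier I ∧
                  (∀ y' : Y, topologicalKrullDim ↥((I.support : Set X) ∩ f ⁻¹' {y'}) ≤ 0) ∧
                    (I.support : Set X) ∩ f ⁻¹' {y} ⊆ f.smoothLocus ∧
                      IsReduced ((I.subschemeι ≫ f).fiber y) ∧
                        ∀ (K : Type u) [Field K] [IsAlgClosed K] (yb : Spec (.of K) ⟶ Y),
                          IsReduced (pullback (I.subschemeι ≫ f) yb) →
                            ∀ C ∈ irreducibleComponents ↥(pullback f yb),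
                              3 ≤ (C ∩ (pullback.fst f yb) ⁻¹' (I.support : Set X)).encard

/-- NAMED FACT — **de Jong 1996, proof of Lemma 4.13: `f|_H` is étale over a neighbourhood of
`y`.** For `f : X → Y` as in Lemma 4.13, a closed point `y ∈ Y(k)` and an effective Cartier
divisor `H = V(I) ⊂ X` with `f|_H : H → Y` finite, `H ∩ f⁻¹(y) ⊂ sm(X/Y)` and `H ∩ f⁻¹(y)`
(scheme-theoretic) reduced: "At each of the intersection points `x ∈ f⁻¹(y) ∩ H` we have
[`𝒪_{Y,y} → 𝒪_{X,x}` smooth] since `f` is smooth at `x`. Further `H` is defined by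
`(h) ⊂ 𝒪_{X,x}` with `h̄ ∉ 𝔪²`, as `H ∩ f⁻¹(y)` [is reduced]. Therefore `f|_H : H → Y` is finite
étale over a neighbourhood of `y` in `Y`. (Actually, we could also have used 2.8 to see this, at
least if `Y` is, say, normal.)" Rendered: there is an open `V ∋ y` of `Y` with
`f|_H : H ∩ f⁻¹(V) → V` étale (Mathlib: `Etale ((I.subschemeι ≫ f) ∣_ V)`; finiteness over `V`
is inherited). Inputs: `h̄` is a regular parameter of the one-dimensional regular local ring
`𝒪_{f⁻¹(y),x}`, so `𝒪_{H,x} = 𝒪_{X,x}/(h)` is flat over `𝒪_{Y,y}` (EGA IV₃ 11.3.8) with fibre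
`κ(x) = κ(y)`, i.e. `f|_H` is étale at every point over `y`; the étale locus is open and `f|_H`
is closed. Users take `(h : DeJong1996MultisectionEtaleNhd)`.
[cite: DeJong1996, Lemma 4.13 (proof), p. 70] -/
def DeJong1996MultisectionEtaleNhd : Prop :=
  ∀ (k : Type u) [Field k] [IsAlgClosed k] (X Y : Scheme.{u}) [IsIntegral X] [IsIntegral Y]
    (f : X ⟶ Y) [LocallyOfFinitePresentation f] (g : Y ⟶ Spec (.of k)),
    Literature.AlgebraicGeometry.Motives.IsProjectiveOver (Over.mk (f ≫ g)) →
      Literature.AlgebraicGeometry.Motives.IsProjectiveOver (Over.mk g) →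
        Surjective f → GeometricallyConnected f →
          (∀ (y : Y), ∀ C ∈ irreducibleComponents ↥(f.fiber y), topologicalKrullDim ↥C = 1) →
            (∀ y : Y, Dense ((f.fiberι y) ⁻¹' (f.smoothLocus : Set X))) →
              ∀ y : Y, IsClosed ({y} : Set Y) →
                ∀ I : X.IdealSheafData, IsEffectiveCartier I → IsFinite (I.subschemeι ≫ f) →
                  (I.support : Set X) ∩ f ⁻¹' {y} ⊆ f.smoothLocus →
                    IsReduced ((I.subschemeι ≫ f).fiber y) →
                      ∃ V : Y.Opens, y ∈ V ∧ Etale ((I.subschemeι ≫ f) ∣_ V)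

/-- NAMED FACT — **de Jong 1996, proof of Lemma 4.13: "Any component of `H` dominates `Y` in
view of dimensions, hence `f|_H` is generically étale."** For `f : X → Y` as in Lemma 4.13 and
an effective Cartier divisor `H = V(I) ⊂ X` with `f|_H : H → Y` finite and étale over a
non-empty open `V ⊆ Y`: every irreducible component of `H` has dimension `dim X - 1 = dim Y`
and so maps onto `Y`, hence meets `f⁻¹(V)`; thus `H ∩ f⁻¹(V)` — over which `f|_H` is étale,
in particular reduced — is dense in `H`, and `f|_H : H → Y` with its reduced closed subscheme
structure (2.2) is finite and generically étale (2.6): `DeJong1996.IsFiniteGenericallyEtaleOn f H`,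
the form of (i) consumed by 4.14. Inputs: `dim X = dim Y + 1` (fibre dimension), Krull's
Hauptidealsatz and catenarity of varieties, invariance of dimension under finite surjections,
étale over reduced is reduced. Users take `(h : DeJong1996MultisectionGenericallyEtale)`.
[cite: DeJong1996, Lemma 4.13 (proof), p. 70] -/
def DeJong1996MultisectionGenericallyEtale : Prop :=
  ∀ (k : Type u) [Field k] [IsAlgClosed k] (X Y : Scheme.{u}) [IsIntegral X] [IsIntegral Y]
    (f : X ⟶ Y) [LocallyOfFinitePresentation f] (g : Y ⟶ Spec (.of k)),
    Literature.AlgebraicGeometry.Motives.IsProjectiveOver (Over.mk (f ≫ g)) →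
      Literature.AlgebraicGeometry.Motives.IsProjectiveOver (Over.mk g) →
        Surjective f → GeometricallyConnected f →
          (∀ (y : Y), ∀ C ∈ irreducibleComponents ↥(f.fiber y), topologicalKrullDim ↥C = 1) →
            (∀ y : Y, Dense ((f.fiberι y) ⁻¹' (f.smoothLocus : Set X))) →
              ∀ I : X.IdealSheafData, IsEffectiveCartier I → IsFinite (I.subschemeι ≫ f) →
                ∀ V : Y.Opens, (V : Set Y).Nonempty → Etale ((I.subschemeι ≫ f) ∣_ V) →
                  DeJong1996.IsFiniteGenericallyEtaleOn f I.support

/-! ## The assembly of the local step -/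

/-- **The local step of Lemma 4.13 (`DeJong1996MultisectionLocal`) from its three inputs.**
Take the hyperplane section `H = V(I)` of `DeJong1996MultisectionHyperplane` at the closed point
`y`; `X` being Noetherian (projective over `k`) and `f` proper, (A2) makes `f|_H` quasi-finite
hence finite (`isFinite_subschemeι_comp_of_topologicalKrullDim_le_zero`); by (A3), (A4) and
`DeJong1996MultisectionEtaleNhd`, `f|_H` is étale over an open `V ∋ y`, whence (i) by
`DeJong1996MultisectionGenericallyEtale`; shrinking `V` (`f|_H` is closed) gives b)
`H ∩ f⁻¹(V) ⊂ sm(X/Y)` (`exists_opens_support_inter_preimage_subset_smoothLocus`), and a), b)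
with the degree clause (A5) give (ii) over `V`
(`DeJong1996.HasThreeSmoothPointsOver.of_etale_morphismRestrict`).
[cite: DeJong1996, Lemma 4.13 (proof), pp. 69–70] -/
theorem DeJong1996MultisectionLocal.of_hyperplane_of_etaleNhd_of_genericallyEtale
    (hA : DeJong1996MultisectionHyperplane.{u}) (hB : DeJong1996MultisectionEtaleNhd.{u})
    (hC : DeJong1996MultisectionGenericallyEtale.{u}) : DeJong1996MultisectionLocal.{u} := by
  intro k _ _ X Y _ _ f _ g hX hY hsurj hgc hdim hdense y hy
  -- properness of `f` and Noetherianity of `X`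
  haveI : IsProper (f ≫ g) :=
    Literature.AlgebraicGeometry.Motives.IsProjectiveOver.isProper (X := Over.mk (f ≫ g)) hX
  haveI : IsProper g :=
    Literature.AlgebraicGeometry.Motives.IsProjectiveOver.isProper (X := Over.mk g) hY
  haveI : IsProper f := IsProper.of_comp f g
  haveI : IsLocallyNoetherian X := LocallyOfFiniteType.isLocallyNoetherian (f ≫ g)
  haveI : CompactSpace X := QuasiCompact.compactSpace_of_compactSpace (f ≫ g)
  haveI : IsNoetherian X := {}
  -- (A): the hyperplane section at `y`
  obtain ⟨I, hI, hdim0, hsm, hred, hdeg⟩ := hA k X Y f g hX hY hsurj hgc hdim hdense y hy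
  -- "quasi-finite hence finite"
  haveI : IsFinite (I.subschemeι ≫ f) :=
    isFinite_subschemeι_comp_of_topologicalKrullDim_le_zero f I hdim0
  -- (B): étale over a neighbourhood `V` of `y`
  obtain ⟨V, hyV, hVet⟩ := hB k X Y f g hX hY hsurj hgc hdim hdense y hy I hI inferInstance hsm hred
  -- (C): (i)
  have hi : DeJong1996.IsFiniteGenericallyEtaleOn f I.support :=
    hC k X Y f g hX hY hsurj hgc hdim hdense I hI inferInstance V ⟨y, hyV⟩ hVet
  -- shrink `V` for b), keep a)
  obtain ⟨V', hV'V, hyV', hb⟩ :=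
    exists_opens_support_inter_preimage_subset_smoothLocus f I hsm V hyV
  haveI : Etale ((I.subschemeι ≫ f) ∣_ V') := etale_morphismRestrict_of_le _ hV'V
  -- (D): (ii) over `V'`
  exact ⟨I.support, ⟨I, hI, rfl⟩, hi, V', hyV',
    DeJong1996.HasThreeSmoothPointsOver.of_etale_morphismRestrict I V' hb hdeg⟩

/-- **Lemma 4.13 (`DeJong1996MultisectionLemma`) from the three inputs of its local step** and
the proved Noetherian induction `DeJong1996MultisectionLemma.of_local`.
[cite: DeJong1996, Lemma 4.13, pp. 69–70] -/
theorem DeJong1996MultisectionLemma.of_hyperplane_of_etaleNhd_of_genericallyEtale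
    (hA : DeJong1996MultisectionHyperplane.{u}) (hB : DeJong1996MultisectionEtaleNhd.{u})
    (hC : DeJong1996MultisectionGenericallyEtale.{u}) : DeJong1996MultisectionLemma.{u} :=
  DeJong1996MultisectionLemma.of_local
    (DeJong1996MultisectionLocal.of_hyperplane_of_etaleNhd_of_genericallyEtale hA hB hC)

/-- Thm. 4.1 with its generically-étale clause over algebraically closed fields
(`DeJong1996StrongAlgClosed`) from 4.11–4.12, the three inputs of the local step of Lemma 4.13,
4.15–4.22 and 4.23–4.28. [cite: DeJong1996, 4.3–4.28, pp. 66–76] -/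
theorem DeJong1996StrongAlgClosed.of_fibration_hyperplane_etaleNhd_genericallyEtale_toSemiStablePair_resolution
    (h₁ : DeJong1996FibrationReduction.{u}) (hA : DeJong1996MultisectionHyperplane.{u})
    (hB : DeJong1996MultisectionEtaleNhd.{u}) (hC : DeJong1996MultisectionGenericallyEtale.{u})
    (h15 : DeJong1996MultisectionToSemiStablePair.{u}) (hres : DeJong1996SemiStablePairResolution.{u}) :
    DeJong1996StrongAlgClosed.{u} :=
  DeJong1996StrongAlgClosed.of_fibration_multisectionLocal_toSemiStablePair_resolution h₁
    (DeJong1996MultisectionLocal.of_hyperplane_of_etaleNhd_of_genericallyEtale hA hB hC) h15 hres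

/-- Thm. 4.1 (i)+(ii) over every field from 4.5 (`DeJong1996Descent`), 4.11–4.12, the three
inputs of the local step of Lemma 4.13, 4.15–4.22 and 4.23–4.28.
[cite: DeJong1996, 4.3–4.28, pp. 66–76] -/
theorem DeJong1996Strong.of_descent_fibration_hyperplane_etaleNhd_genericallyEtale_toSemiStablePair_resolution
    (h45 : DeJong1996Descent.{u}) (h₁ : DeJong1996FibrationReduction.{u})
    (hA : DeJong1996MultisectionHyperplane.{u}) (hB : DeJong1996MultisectionEtaleNhd.{u})
    (hC : DeJong1996MultisectionGenericallyEtale.{u}) (h15 : DeJong1996MultisectionToSemiStablePair.{u})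
    (hres : DeJong1996SemiStablePairResolution.{u}) : DeJong1996Strong.{u} :=
  DeJong1996Strong.of_descent_fibration_multisectionLocal_toSemiStablePair_resolution h45 h₁
    (DeJong1996MultisectionLocal.of_hyperplane_of_etaleNhd_of_genericallyEtale hA hB hC) h15 hres

end Literature.AlgebraicGeometry.Resolution

end
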